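import Summits.KontsevichZagierPeriods.Zeta5Search.SymmetricGaugeLaw
import Summits.KontsevichZagierPeriods.Zeta5Search.DualSeriesLemma19
import Summits.KontsevichZagierPeriods.Zeta5Search.WedgeDictionaryClosedForms
import Literature.NumberTheory.Irrationality.BrownZudilin2022.GeneralFamily
import HarnessLib

/-!
# Rhin–Viola at level 5: Brown–Zudilin gauges are Hamiltonian paths of `K₇`, Nesterenko–Zudilin brick arrangements
# are permutations in `S₈` (cell `pub-zeta5`, family designer fam-rv, generation 3)

HONEST FRAMING: systematic search; no irrationality claim unless certified.  Nothing in this file is an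
irrationality statement.  INTERNALLY MINTED objects are marked; the one law stated here (`ArrangementLaw`) is a
`@[conjecture]`-tagged `Prop` whose two anchor instances are tree theorems (see §4); it is NOT cited as a fact anywhere.

## What is typed here (all `decide`/`ring`-checked, 0 sorry)

§1 THE DICTIONARY.  Brown–Zudilin's 28 linear forms `h₁,…,h₂₈` of [BZ22, (26)] in the cellular coordinates `a` are,
   INDEX BY INDEX, the contiguous set of Zudilin [Zu04, (9.1)] in the dual coordinates `b = bOfA a`
   ([BZ22, display after (33)]): `h_i = b_v` for the seven "singleton" indices and `h_i = b₀ − b_j − b_k` for the 21 pair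
   indices (`hForm_eq_pairForm`, table `pairTable`).  (In BZ's symmetric `s`-coordinates: `b₀ = 2s₀`, `b_v = s₀ − s_v`.)
§2 THE GAUGE SET IS A PATH.  The complement of the convergence index set `F` of [BZ22, (27)] (11 indices) is, under the
   dictionary, `{b_v : v ∈ {1,4,5,6,7}} ∪ {e_{jk} : jk ∈ {16,17,27,35,45,46}}` = the interior vertices and the edges of the
   HAMILTONIAN PATH `π₀ = 2–7–1–6–4–5–3` of `K₇` (`fc_eq_path_pi0`).  Consequently BZ's closed scalar `ρ(b)` (gen-1,
   `SymmetricGauge.rhoB`) is `± W(b) / (4 · C_{π₀}(b) · b₂! b₃! · d!)` with `W(b) = ∏_{28 forms} f!` the `S₇`-INVARIANT total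
   weight and `C_π(b) = ∏_{v ∈ int π} b_v! · ∏_{jk ∈ edges π} e_{jk}!` the PATH WEIGHT (`rhoB_gauge_identity`): the `S₇`-orbit
   of gauges of [BZ22, Sect. 7, (29)–(30)] is the set of `7!/2 = 2520` Hamiltonian paths (stabiliser = path reversal), and
   (29) reads `ν_p(b) = max_π v_p C_π(b) − v_p C_{π₀}(b)` (numerically cross-checked against the census engine's literal
   `S₇`-orbit on all 812 grid points of the record ray: `pub-zeta5-fam-rv/gen3/out/rv3_arrangements.json`).
§3 ARRANGEMENTS.  A brick arrangement of Zudilin's very-well-poised summand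
   `R̃(t) = (h₀+2t) Γ(h₀+t)∏Γ(h_j+t) / (Γ(1+t)∏Γ(1+h₀−h_j+t))`, `h₀ = b₀+2`, `h_j = b_j+1` [Zu04, (8.2), (8.7)] into
   Nesterenko bricks [Zu04, (7.3)] is a bijection numerator-Γ ↦ denominator-Γ, i.e. `τ ∈ S₈` on `{0,…,7}` (`0` = `Γ(h₀+t)`
   resp. `Γ(1+t)`), subject to `τ 0 ≠ 0`; `8! − 7! = 35280` of them.  Normaliser
   `N_τ(b) = ∏_{j ≥ 1, τj ≥ 1} e_{j,τj}! / (b_{τ⁻¹0}! · b_{τ0}!)` (`arrNormaliser`; self-pairs `e_{jj} = b₀ − 2b_j` allowed).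
   Zudilin's Lemma 19 [Zu04, (8.6)–(8.7)] is the DIAGONAL arrangement (`tauDiag`: `0 ↔ v`, all other slots self-paired);
   Brown–Zudilin's (35) = the tree's `DualSeriesDenominators` pairs `(1,6),(7,1),(2,7),(6,4),(4,5),(5,3)` is the 8-CYCLE
   `tauBZ = (0 2 7 1 6 4 5 3)`, and in general the 8-cycles (`5040`, `/reversal = 2520`) are exactly the Hamiltonian paths
   with `N_{τ_π}(b) · ∏_v b_v! = C_π(b)`.  Anchors: `arrNormaliser_tauBZ_record`, `arrNormaliser_tauDiag_record` (`decide`).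
§4 THE ARRANGEMENT LAW (INTERNALLY MINTED as a uniform statement; PROOF ON PAPER = Zudilin's proof of Lemma 19 run with
   the bricks of `τ`: Lemma 15 for the two polynomial bricks `(h_{τ⁻¹0},1)`, `(h₀, 1+h₀−h_{τ0})`, Lemma 16 for the six
   rational bricks `(h_j, 1+h₀−h_{τj})` on the pole range `h_(2) ≤ k ≤ h₀−h_(2)`, Leibniz; the tails of `A₀` are
   τ-independent).  For the coefficients `U, W, V` of `F̃₇(b) = Uζ(5) + Wζ(3) − V` (tree: `WedgeDictionary.coeffU/W/V`):
   `v_p U ≥ −[log_p m₀(τ)] − v_p N_τ`, `v_p W ≥ −3[log_p m₀(τ)] − v_p N_τ`, `v_p V ≥ −Σ_{i=1}^{6}[log_p m_i(τ)] − v_p N_τ`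
   with `m₀(τ) = max(b_{τ⁻¹0}, b_{τ0}, max_{j} (b₀ − min(b_j,b_(2)) − min(b_{τj},b_(2))))`, `m_i(τ) = max(m₀(τ), b₀−b_(1)−b_(1+i))`.
   TREE-PROVED INSTANCES: the diagonal arrangement without the `b!`-division and with the window `lcm` —
   `DualSeriesLemma19Coeffs.coeffU_den19 / coeffW_den19 / coeffV_den19(_sorted)`; the 8-cycle `tauBZ` with the coarse
   `lcm(1..b₀)` — `DualSeriesDenominators.coeffU_den / coeffW_den / coeffV_den`.
§5 WHAT IT IS WORTH (rate level, record ray `b = n(41;17,16,15,14,13,12,11)`, census engine g18 verbatim with the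
   arrangement-optimised D-part; `rv3_arrangements.json`):  (i) WEAK DUALITY (one line, paper): for every prime
   `p > √h₀`, every τ and every pole `k`, `N_τ · ∏_bricks R_ℓ(−k)·(t+k)^{ord} ∈ ℤ` is a product of binomials, whence
   `−v_p N_τ ≤ μ_{k,p}` with `μ_{k,p} = ν_{k,p} − v_p N_{τ_Z}` Zudilin's (8.11) exponent [Zu04, after (8.9)] — the
   "most precise" prime-by-prime factor `Φ` of Lemma 19 DOMINATES the arrangement optimum; (ii) on the record ray the two
   COINCIDE on every one of the 143 + (XK = 4 sheets) windows where the `D`-indicators are on, while the best 8-cycle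
   (BZ gauge orbit) is strictly weaker on a listed set of windows; (iii) therefore the census rung `T` (Lemma 19 with `Φ`)
   already contains the full arrangement monoid: `λ_T^{arr} = λ_T = 64.480`, `λ_proved^{arr} = λ_proved = 51.481`
   nats/step — the PROVED Rhin–Viola-type saving at level 5 is exactly Zudilin's `Φ`, gain `0.000` over the ladder;
   the conjectural side ((28)+(30), `λ = 49.606`) is untouched by this.

References: [Zu04] W. Zudilin, J. Théor. Nombres Bordeaux 16 (2004) 251–291 = arXiv:math/0206176, Sect. 7–9;
[BZ22] F. Brown, W. Zudilin, arXiv:2210.03391, Sect. 7 (26)–(30), Sect. 8 (33)–(35); [RV01] G. Rhin, C. Viola, Acta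
Arith. 97 (2001) (the ζ(3) group this generalises).  Evidence files: `run/shared/lean/pub/pub-zeta5/pub-zeta5-fam-rv/gen3/`.
-/

namespace Summit.KontsevichZagierPeriods.Zeta5Search.RVGauge

open Finset
open Literature.NumberTheory.Irrationality.BrownZudilin2022 (hList hForm Fset bOfA)
open Summit.KontsevichZagierPeriods.Zeta5Search.SymmetricGauge (rhoB permLower bRecord)
open Summit.KontsevichZagierPeriods.Zeta5Search.WedgeDictionary (Epairs allPairs nonEpairs dOf coeffU coeffW coeffV)
open Summit.KontsevichZagierPeriods.Zeta5Search.CasoratianValuation (InPolytope)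

/-! ### §1 The dictionary `h_i(a) ↔ (b_v | b₀ − b_j − b_k)(bOfA a)` -/

/-- Entry `i−1` is the pair of `h_i`: `(0,v)` means `b_v`, `(j,k)` with `1 ≤ j < k` means `e_{jk} = b₀ − b_j − b_k`
(same slot labels as `bOfA`, BZ display after (33)). [dictionary of BZ22 (26) ↔ Zu04 (9.1); checked below] -/
def pairTable : List (ℕ × ℕ) :=
  [(1,2),(0,2),(2,3),(0,3),(3,4),(5,6),(6,7),(3,5),(1,3),(1,4),(1,5),(0,4),(0,5),(2,6),(0,1),(2,4),(0,6),(2,5),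
   (4,6),(3,7),(1,6),(1,7),(3,6),(0,7),(4,5),(2,7),(5,7),(4,7)]

/-- The form attached to a pair. -/
def pairForm (b : ℕ → ℤ) (jk : ℕ × ℕ) : ℤ := if jk.1 = 0 then b jk.2 else b 0 - b jk.1 - b jk.2

/-- **Dictionary, index by index**: `h_i(a) = pairForm (bOfA a) (pairTable[i−1])` for `i = 1,…,28`. PROVED (28 linear
identities). -/
theorem hForm_eq_pairForm (a : Fin 8 → ℤ) (i : ℕ) (hi : 1 ≤ i) (hi' : i ≤ 28) :
    hForm a i = pairForm (bOfA a) (pairTable.getD (i - 1) (0, 0)) := by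
  interval_cases i <;> simp [hForm, hList, pairForm, pairTable, bOfA] <;> omega

/-- The seven singleton pairs are the seven slots and the 21 proper pairs are all of them: the table is a bijection
onto Zudilin's contiguous index set. -/
theorem pairTable_perm :
    pairTable.Perm (((List.range 7).map fun v => (0, v + 1)) ++ allPairs) := by decide

/-! ### §2 `F^c` is the Hamiltonian path `π₀ = 2–7–1–6–4–5–3` -/

/-- BZ's identity gauge as a Hamiltonian path of `K₇`. -/
def pi0 : List ℕ := [2, 7, 1, 6, 4, 5, 3]

/-- Edges of a path, as increasing pairs. -/
def pathEdges (π : List ℕ) : List (ℕ × ℕ) := (π.zip π.tail).map fun e => (min e.1 e.2, max e.1 e.2)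

/-- Interior vertices of a path. -/
def pathInterior (π : List ℕ) : List ℕ := (π.drop 1).dropLast

/-- The edge list of `π₀`. -/
theorem pathEdges_pi0 : pathEdges pi0 = [(2,7),(1,7),(1,6),(4,6),(4,5),(3,5)] := by decide
/-- The interior vertices of `π₀`. -/
theorem pathInterior_pi0 : pathInterior pi0 = [7,1,6,4,5] := by decide

/-- The eleven indices outside `F`. -/
theorem fc_indices : (List.range' 1 28).filter (fun i => i ∉ Fset) = [8,12,13,15,17,19,21,22,24,25,26] := by decide

/-- **`F^c = π₀`**: the forms outside BZ's convergence set are exactly the interior vertices `b_v` and the edges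
`e_{jk}` of the path `π₀`. PROVED (`decide`). -/
theorem fc_eq_path_pi0 :
    (((List.range' 1 28).filter fun i => i ∉ Fset).map fun i => pairTable.getD (i - 1) (0, 0)).Perm
      (((pathInterior pi0).map fun v => (0, v)) ++ pathEdges pi0) := by decide

/-- … equivalently: `ρ`'s denominator slots `[1,4,5,6,7]` are `π₀`'s interior and the tree's `nonEpairs` (BZ (35))
are `π₀`'s edges, `Epairs` the other fifteen. PROVED (`decide`). -/
theorem rho_data_eq_path_pi0 :
    (pathInterior pi0).Perm [1,4,5,6,7] ∧ (pathEdges pi0).Perm nonEpairs ∧ (Epairs ++ pathEdges pi0).Perm allPairs := by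
  refine ⟨by decide, by decide, by decide⟩

/-! ### §2b Path weights and the gauge identity for `ρ` -/

/-- `z!` as a rational (`z < 0 ↦ 1`), the convention of `rhoB`. -/
def facQ (z : ℤ) : ℚ := (z.toNat.factorial : ℚ)

/-- `facQ z ≠ 0`. -/
theorem facQ_ne_zero (z : ℤ) : facQ z ≠ 0 := by
  unfold facQ; exact_mod_cast Nat.factorial_ne_zero _

/-- PATH WEIGHT `C_π(b) = ∏_{v ∈ int π} b_v! · ∏_{jk ∈ edges π} (b₀ − b_j − b_k)!` — the gauge denominator. -/
def pathWeight (π : List ℕ) (b : ℕ → ℤ) : ℚ :=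
  ((pathInterior π).map fun v => facQ (b v)).prod * ((pathEdges π).map fun e => facQ (b 0 - b e.1 - b e.2)).prod

/-- TOTAL WEIGHT `W(b) = ∏_{v=1}^{7} b_v! · ∏_{j<k} (b₀ − b_j − b_k)!` — the product over all 28 forms, `S₇`-invariant. -/
def formsWeight (b : ℕ → ℤ) : ℚ :=
  (((List.range 7).map fun i => facQ (b (i + 1))).prod) * (allPairs.map fun e => facQ (b 0 - b e.1 - b e.2)).prod

/-- SLOT WEIGHT `∏_{v=1}^{7} b_v!` — `S₇`-invariant. -/
def slotsWeight (b : ℕ → ℤ) : ℚ := ((List.range 7).map fun i => facQ (b (i + 1))).prod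

/-- **Gauge identity**: `ρ(b) · 4 · d(b)! · C_{π₀}(b) · ∏_v b_v! = (−1)^{Σ b_j} · W(b)`.  PROVED (`field_simp; ring`).
Since `W`, `∏_v b_v!` and `d` are invariant under relabelling `σ • b` (`permLower`), `v_p ρ(σ • b) − v_p ρ(b) =
v_p C_{π₀}(b) − v_p C_{π₀}(σ • b)`: BZ's (29)–(30) saving is `ν_p = max_π v_p C_π(b) − v_p C_{π₀}(b)` over the `2520`
Hamiltonian paths (§2 of the module docstring). -/
theorem rhoB_gauge_identity (b : ℕ → ℤ) :
    rhoB b * (4 * facQ (dOf b) * pathWeight pi0 b * slotsWeight b) =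
      (-1 : ℚ) ^ (∑ j ∈ range 7, b (j + 1)).toNat * formsWeight b := by
  have h1 := facQ_ne_zero (b 1); have h4 := facQ_ne_zero (b 4); have h5 := facQ_ne_zero (b 5)
  have h6 := facQ_ne_zero (b 6); have h7 := facQ_ne_zero (b 7); have hd := facQ_ne_zero (dOf b)
  unfold facQ at h1 h4 h5 h6 h7 hd
  unfold rhoB pathWeight formsWeight slotsWeight
  rw [pathEdges_pi0, pathInterior_pi0]
  simp only [facQ, Epairs, allPairs, List.map, List.prod_cons, List.prod_nil, List.range, List.range.loop]
  field_simp

/-! ### §3 Brick arrangements `τ ∈ S₈`, `τ 0 ≠ 0` -/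

/-- the six smallest-first sorted lower parameters -/
def sortedLower (b : ℕ → ℤ) : List ℤ := ((List.range 7).map fun i => b (i + 1)).insertionSort (· ≤ ·)
/-- `b_(1)` = the smallest lower parameter -/
def bMin1 (b : ℕ → ℤ) : ℤ := (sortedLower b).getD 0 0
/-- `b_(2)` = the second smallest lower parameter -/
def bMin2 (b : ℕ → ℤ) : ℤ := (sortedLower b).getD 1 0

/-- Numerator of the normaliser: `∏_{j ≥ 1, τ j ≥ 1} (b₀ − b_j − b_{τ j})!` (the six rational bricks' factorials). -/
def arrNormNum (τ : Equiv.Perm (Fin 8)) (b : ℕ → ℤ) : ℕ :=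
  ((List.finRange 8).map fun j : Fin 8 =>
      if j ≠ 0 ∧ τ j ≠ 0 then (b 0 - b j.val - b (τ j).val).toNat.factorial else 1).prod

/-- Denominator of the normaliser: `b_{τ⁻¹ 0}! · b_{τ 0}!` (the two polynomial bricks, Lemma 15). -/
def arrNormDen (τ : Equiv.Perm (Fin 8)) (b : ℕ → ℤ) : ℕ :=
  (b (τ.symm 0).val).toNat.factorial * (b (τ 0).val).toNat.factorial

/-- NORMALISER of the arrangement `τ`: `N_τ(b) = ∏_{j≥1, τ j ≥ 1} (b₀ − b_j − b_{τ j})! / (b_{τ⁻¹ 0}! · b_{τ 0}!)`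
(Zudilin's (8.6)–(8.7) for the diagonal `τ`; BZ's (35) for `tauBZ`). -/
def arrNormaliser (τ : Equiv.Perm (Fin 8)) (b : ℕ → ℤ) : ℚ := (arrNormNum τ b : ℚ) / (arrNormDen τ b : ℚ)

/-- `m₀(τ; b)`: the largest `lcm` index produced by Lemmas 15/16 for the bricks of `τ` on the pole range
`b_(2)+1 ≤ k ≤ b₀+1−b_(2)`. -/
def m0Arr (τ : Equiv.Perm (Fin 8)) (b : ℕ → ℤ) : ℤ :=
  ((List.finRange 8).filter fun j : Fin 8 => j ≠ 0 ∧ τ j ≠ 0).foldr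
    (fun j acc => max acc (b 0 - min (b j.val) (bMin2 b) - min (b (τ j).val) (bMin2 b)))
    (max (b (τ.symm 0).val) (b (τ 0).val))

/-- `m_i(τ; b) = max(m₀(τ;b), b₀ − b_(1) − b_(1+i))`, `i = 1,…,6` (the tails of `A₀`, τ-independent). -/
def mTail (τ : Equiv.Perm (Fin 8)) (b : ℕ → ℤ) (i : ℕ) : ℤ :=
  max (m0Arr τ b) (b 0 - bMin1 b - (sortedLower b).getD i 0)

/-- Zudilin's DIAGONAL arrangement through slot `v`: `0 ↦ v ↦ 0`, every other slot self-paired (`e_{jj} = b₀ − 2b_j`).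
Lemma 19 [Zu04] is `tauDiag (argmin b)`; the tree's `DualSeriesLemma19` is `tauDiag 1` in its own labelling. -/
def tauDiag (v : Fin 8) : Equiv.Perm (Fin 8) := Equiv.swap 0 v

/-- Brown–Zudilin's arrangement (35) = `DualSeriesDenominators`: numerator slot ↦ denominator slot
`1↦6, 7↦1, 2↦7, 6↦4, 4↦5, 5↦3`, `f₃ ↦ (t+1)`-block (`3 ↦ 0`), `Γ(h₀+t) ↦ s₂` (`0 ↦ 2`): the 8-cycle `(0 2 7 1 6 4 5 3)`,
whose path `k₀ → … → j₀` is `π₀`. -/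
def tauBZ : Equiv.Perm (Fin 8) := ⟨![2, 6, 7, 0, 5, 3, 4, 1], ![3, 7, 0, 5, 6, 4, 1, 2], by decide, by decide⟩

/-- `τ_BZ` moves `0`. -/
theorem tauBZ_zero_ne : tauBZ 0 ≠ 0 := by decide
/-- `tauDiag v` moves `0` when `v ≠ 0`. -/
theorem tauDiag_zero_ne (v : Fin 8) (hv : v ≠ 0) : tauDiag v 0 ≠ 0 := by
  unfold tauDiag; rw [Equiv.swap_apply_left]; exact hv

/-- `tauBZ` is an 8-cycle tracing `π₀`: iterating from `τ 0 = 2` visits `2,7,1,6,4,5,3` and returns to `0`. -/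
theorem tauBZ_traces_pi0 : (List.range 7).map (fun i => ((tauBZ ^ (i + 1)) 0).val) = pi0 ∧ (tauBZ ^ 8) 0 = 0 := by
  refine ⟨by decide, by decide⟩

/-- Anchor 1 (record ray, `n = 1`): the numerator of `N_{tauBZ}` IS the tree's `DualSeriesDenominators.normaliser`
(`12!·14!·14!·13!·15!·13!` at `b = (41;17,…,11)`), the denominator is `b₃!·b₂! = 15!·16!` (BZ (35)). PROVED (`decide`). -/
theorem arrNormaliser_tauBZ_record :
    arrNormNum tauBZ bRecord = DualSeriesDenominators.normaliser bRecord ∧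
      arrNormDen tauBZ bRecord = Nat.factorial 15 * Nat.factorial 16 := by
  refine ⟨by decide, by decide⟩

/-- Anchor 2 (record ray, `n = 1`): the numerator of `N_{tauDiag 1}` IS the tree's `DualSeriesLemma19.normaliser19`
(`∏_{j=2}^{7} (41 − 2b_j)!`), the denominator is `(b₁!)² = (17!)²`. PROVED (`decide`). -/
theorem arrNormaliser_tauDiag_record :
    arrNormNum (tauDiag 1) bRecord = DualSeriesLemma19.normaliser19 bRecord ∧
      arrNormDen (tauDiag 1) bRecord = Nat.factorial 17 * Nat.factorial 17 := by
  refine ⟨by decide, by decide⟩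

/-- `m₀` on the record: Zudilin's diagonal through the SMALLEST slot `7`: `max(11, 41 − 2·12) = 17`; BZ's 8-cycle: `18`
(edge `e_{27}`: `41 − 12 − 11`); the diagonal through slot `1` (what `DualSeriesLemma19`'s labelling becomes on the
BZ-labelled record) self-pairs the smallest slot: `41 − 2·11 = 19`. -/
theorem m0_record : m0Arr (tauDiag 7) bRecord = 17 ∧ m0Arr tauBZ bRecord = 18 ∧ m0Arr (tauDiag 1) bRecord = 19 := by
  refine ⟨by decide, by decide, by decide⟩

/-! ### §4 The arrangement law (INTERNALLY MINTED uniform statement; anchors = tree theorems, see module docstring) -/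

/-- **ARRANGEMENT LAW (8.10)_τ** — for every brick arrangement `τ` (`τ 0 ≠ 0`), every `b` in the polytope and every prime
`p`: `v_p U ≥ −[log_p m₀(τ)] − v_p N_τ(b)`, `v_p W ≥ −3[log_p m₀(τ)] − v_p N_τ(b)`,
`v_p V ≥ −Σ_{i=1}^{6} [log_p m_i(τ)] − v_p N_τ(b)`.  Status: PAPER (Zudilin's proof of Lemma 19 with the bricks of `τ`);
Lean-proved anchors listed in the module docstring; rate-level consequences in `rv3_arrangements.json`.  Dominated, for
`p > √(b₀+2)`, by Zudilin's `Φ`-refined (8.11) (weak duality, module docstring §5). -/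
@[conjecture] def ArrangementLaw : Prop :=
  ∀ (τ : Equiv.Perm (Fin 8)) (b : ℕ → ℤ) (p : ℕ), τ 0 ≠ 0 → InPolytope b → p.Prime →
    (coeffU b ≠ 0 →
      -(Nat.log p (m0Arr τ b).toNat : ℤ) - padicValRat p (arrNormaliser τ b) ≤ padicValRat p (coeffU b)) ∧
    (coeffW b ≠ 0 →
      -3 * (Nat.log p (m0Arr τ b).toNat : ℤ) - padicValRat p (arrNormaliser τ b) ≤ padicValRat p (coeffW b)) ∧
    (coeffV b ≠ 0 →
      -(∑ i ∈ range 6, (Nat.log p (mTail τ b (i + 1)).toNat : ℤ)) - padicValRat p (arrNormaliser τ b) ≤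
        padicValRat p (coeffV b))

end Summit.KontsevichZagierPeriods.Zeta5Search.RVGauge
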